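import Literature.MathematicalPhysics.QuantumFieldTheory.Balaban1983to89.B9SupplySockB9P3ZdLocalLettersOfOps
import Literature.MathematicalPhysics.QuantumFieldTheory.Balaban1983to89.B9Eq347GlobalFromLocal

/-!
# `Balaban1983to89.B9Eq347GlobalFromLocalZd` — [Balaban1985BackgroundPropagators] Thm 3.1∕3.3 p. 398 l. 19–20 *«It is easy to see that the global
# inequalities (3.47) are consequences of the local ones (3.42) and Lemma 2.1»* FOR THE GENUINE OPERATOR `G(U₀)` AT THE `ℤᵈ × 𝔸` FRAME: the (3.47)-type
# weighted global sup bounds of `G(U₀)J`, `∇_{U₀}G(U₀)J`, `G(U₀)∇*_{U₀}J`, `Δ_{U₀}G(U₀)J` FROM the (3.42) block of `B9.Ineq342_346_347` AT THE PINNED READINGS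
# (`B9SupplySockB9P3ZdLocalLettersOfOps.GAZdOfOps`), on members with finitely many blocks, by the abstract summation `B9Eq347GlobalFromLocal` (leaf-03)

statement-level skeleton of published theorems with citation tags; proofs where landed; nothing here is a claim about the
Yang–Mills mass gap

PDF held: `paper:balaban1985-cmp99-background-propagators` ([4] = B9; journal page = PDF page + 388), pp. 397–398 (3.41), (3.42), (3.47), l. 19–20;
[Balaban1984PropagatorsII] p. 234 Lemma 2.1 (2.60)–(2.61).  Quoted verbatim in `B9Eq347GlobalFromLocal` (pub-balaban leaf-03) and `B9.lean` — BY NAME.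

WHY THIS FILE (cell `pub-ymgap`, HUMAN RULING D-0062 ∕ D-0149; seat `pub-ymgap-dag-n06-w2` (g0), node N06 = [B9]; INTENT-4; count-neutral).  What the
pinning of the frame's local letters (p588432, dag-n06-b DESIGN-ANSWER (α)) buys FIRST: once `loc := locOfOpsZd`, the (3.42) block of the junction's
hypothesis `B9.Thm33Printed … (GAZdFamOfOps …)` is a statement about the operator `G(U₀)` on block pairs, and print's «easy to see» passage from (3.42) to
the global weighted bounds (3.47) becomes a THEOREM for the genuine operator — leaf-03's abstract `weight_mul_norm_apply_le_of_local` (one summation over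
the source blocks; the two clauses of [4] Lemma 2.1 DISPLAYED as the exchange letter (2.60) and the row letter (2.61)) instantiated at the `ℤᵈ` frame:
source∕output sites = a bond class with a base-block assignment, blocks = `BSite L x` (finite), distance = `distZd`, local factor = `pref4 (Lʲη) n`.

WHAT IS DECLARED ∕ PROVED (0 sorry; ONE small `def` — `extZd`, the extension by zero from a bond class).
* §1 `finite_inBox`, `finite_blockZd`, `finite_bondTouches` (the bonds touching a block are finitely many), ★ `norm_le_supBlkZd` (the block supremum of
  (3.42) IS ATTAINED: `‖Ψ(b)‖ ≤ supBlkZd L y Ψ` for `b` touching `Δ(y)`), `supNormZd_le_of_forall`.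
* §2 `extZd P g` + `extZd_apply_of ∕ _apply_of_not ∕ _add ∕ _smul`.
* §3 ℝ-LINEARITY OF THE LETTERS: `covDerivFwd_linear`, `covDeriv_linear` (B8 (1.1)), `cdBZd_linear`, `cdsBZd_linear`, `lapBZd_linear`.
* §4 ★★ `weight_mul_norm_le_of_reading` — THE GENERIC SUMMATION: member `x` with `[Fintype (BSite L x)]`; an ℝ-linear letter `Θ` on bond fields (displayed
  `hΘ`) DOMINATED by the entry-`n` reading of `G(U)` (`‖(Θ J)(b)‖ ≤ eOfOps n U J (π b)` — `Θ = G`, `∇_ν∘G`, `G∘∇*_ν`, `Δ∘G`; `comp_linear`); the (3.42) block of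
  `B9.Ineq342_346_347 (GAZdOfOps … ops) B₀ δ₀ U`; a bond class `P` with base-block assignment `π`, `hπ : b.1 ∈ Δ(π b)`; the two Lemma-2.1 letters DISPLAYED
  (exchange `ω′(u)·pref4(L^{j_u}η) n ≤ R·e^{κ₂d(u,v)}·ω(v)`, row `Σ_v e^{−(δ₀−κ₂)d(u,v)} ≤ S`) ⟹ `ω′(π b)·‖(Θ f̃)(b)‖ ≤ B₀·R·S·M` whenever
  `ω(π y)·‖f(y)‖ ≤ M` (`f̃ = extZd P f`).
* §5 the four (3.47) entries: ★★ `weight_mul_norm_gop_le_of_ineq342` (n = 0, `G J`, factor `(Lʲη)²`), ★★ `weight_mul_norm_gradGop_le_of_ineq342`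
  (n = 1, `∇_{U,ν}G J`, factor `Lʲη`), ★★ `weight_mul_norm_gopDiv_le_of_ineq342` (n = 2, `G∇*_{U,ν}J`), ★★ `weight_mul_norm_lapGop_le_of_ineq342` (n = 3,
  `Δ_U G J`, factor `1`) — at `γ = −3` the n = 0, 1, 3 entries are the three left-hand sides of B8 (1.59) (`DictGlob`).

HONEST SCOPE.  (i) Finite-sum bookkeeping over leaf-03's abstract theorem and p588432's readings; `G(U₀)` stays a letter; its linearity, the block
assignment and the two Lemma-2.1 letters are DISPLAYED hypotheses.  (ii) LOCATED (not asserted, for n06-e's frame): `distZd` is `SimpleGraph.dist` of the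
admissible-bond graph (junk `0` between blocks joined by no chain), so `DistOK ∕ LevelGap ∕ RowSum261`-type schemas for `geoZd` (the torus lineage's
`B9Ineq349Whole` currency) need a connectivity ∕ finiteness guard before the displayed letters can be discharged from (2.60)–(2.61) — here they stay
letters.  (iii) The univ road (`Ω₀ = ℤᵈ`, infinitely many blocks) is NOT covered (infinite block sums need the kernel form of `G`).  (iv) Count-neutral;
N05 ∕ N06 NOT discharged; one finite lattice programme at fixed `ε`; R4 closes the conditional finite-𝕋⁴ rung `BalabanLadder.UV` only; nothing continuum ∕
ℝ⁴ ∕ OS ∕ mass-gap ∕ Clay.  Unit `pub-ymgap-dag-n06-w2` (g0), 2026-08-28.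
-/

noncomputable section

namespace Literature.MathematicalPhysics.QuantumFieldTheory.Balaban1983to89.B9Eq347GlobalFromLocalZd

open B7Prop1Local (InBox)
open B8Ineq132 (covDerivFwd covDeriv BondTouches)
open B8LeafModelZd (ZdIdx)
open B9SupplySockB9P3ZdLetters (OpsZd)
open B9SupplySockB9P3ZdFrame (MemberZd BSite blockZd CfgZd geoZd distZd supNormZd)
open B9SupplySockB9P3ZdLocalLettersOfOps (cdBZd cdsBZd lapBZd supBlkZd supBlkZd_nonneg eOfOps GAZdOfOps ineq342_of_GAZdOfOps)
open B9Eq347GlobalFromLocal (weight_mul_norm_apply_le_of_local)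

-- `Site` alone could resolve to the torus sites of `Setup.lean`; re-export the `ℤ^d` sites of `B7Prop1Explicit`.
export B7Prop1Explicit (Site)

variable {d : ℕ}

/-! ## §1 The bonds touching a block are finitely many; the block supremum is attained -/

/-- a box `InBox lo hi` of `ℤᵈ` is a finite set (`Set.finite_Icc` in `Fin d → ℤ`). [cite: Balaban1985BackgroundPropagators, p.397 («Δ(y) is a cube»)] -/
theorem finite_inBox (lo hi : Site d) : Set.Finite {z : Site d | InBox lo hi z} := by
  refine (Set.finite_Icc lo hi).subset ?_
  intro z hz
  exact ⟨fun i => (hz i).1, fun i => (hz i).2⟩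

/-- the block `Δ(y)` is finite. [cite: Balaban1985BackgroundPropagators, p.397 («Δ(y) is a cube»)] -/
theorem finite_blockZd (L j : ℕ) (y : Site d) : Set.Finite (blockZd L j y) :=
  finite_inBox _ _

/-- **the bonds touching a finite set of sites are finitely many** (a bond `⟨z, z+e_μ⟩` touches `S` iff `z ∈ S` or `z + e_μ ∈ S`).
[cite: Balaban1985RegularSpaces, p.77 (bond convention)] -/
theorem finite_bondTouches {S : Set (Site d)} (hS : S.Finite) : Set.Finite {b : Site d × Fin d | BondTouches S b.1 b.2} := by
  have h1 : Set.Finite {b : Site d × Fin d | b.1 ∈ S} :=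
    (hS.prod (Set.finite_univ : (Set.univ : Set (Fin d)).Finite)).subset fun b hb => ⟨hb, Set.mem_univ _⟩
  have h2 : Set.Finite {b : Site d × Fin d | b.1 + B7Prop1Explicit.e b.2 ∈ S} := by
    have hf : Set.Finite ((fun p : Site d × Fin d => (p.1 - B7Prop1Explicit.e p.2, p.2)) '' {b : Site d × Fin d | b.1 ∈ S}) :=
      h1.image _
    refine hf.subset ?_
    intro b hb
    exact ⟨(b.1 + B7Prop1Explicit.e b.2, b.2), hb, by simp⟩
  exact (h1.union h2).subset fun b hb => hb.elim (fun h => Or.inl h) fun h => Or.inr h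

/-- ★ **THE BLOCK SUPREMUM OF (3.42) IS ATTAINED**: `‖Ψ(b)‖ ≤ supBlkZd L y Ψ` for every bond `b` touching `Δ(y)` (finite index set, so the real `iSup`
is a genuine supremum). [cite: Balaban1985BackgroundPropagators, (3.42) p.397 («for x ∈ Δ(y)»)] -/
theorem norm_le_supBlkZd {𝔸 : Type*} [SeminormedAddCommGroup 𝔸] (L : ℕ) {x : MemberZd d L} (y : BSite L x)
    (Ψ : Site d → Fin d → 𝔸) {z : Site d} {μ : Fin d} (hb : BondTouches (blockZd L y.1.1 y.1.2) z μ) :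
    ‖Ψ z μ‖ ≤ supBlkZd L y Ψ := by
  have hfin : Set.Finite (Set.range fun b : {b : Site d × Fin d // BondTouches (blockZd L y.1.1 y.1.2) b.1 b.2} => ‖Ψ b.1.1 b.1.2‖) := by
    haveI : Finite {b : Site d × Fin d // BondTouches (blockZd L y.1.1 y.1.2) b.1 b.2} :=
      (finite_bondTouches (finite_blockZd L y.1.1 y.1.2)).to_subtype
    exact Set.finite_range _
  exact le_ciSup hfin.bddAbove ⟨(z, μ), hb⟩

/-- the sup norm (3.39) of a field pointwise bounded by `F ≥ 0` is at most `F`. [cite: Balaban1985BackgroundPropagators, (3.39) p.397] -/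
theorem supNormZd_le_of_forall {𝔸 : Type*} [SeminormedAddCommGroup 𝔸] {J : Site d → Fin d → 𝔸} {F : ℝ} (hF : 0 ≤ F)
    (h : ∀ z μ, ‖J z μ‖ ≤ F) : supNormZd J ≤ F :=
  Real.iSup_le (fun b => h b.1 b.2) hF

/-! ## §2 Extension by zero from a bond class -/

section Ext

variable {𝔸 : Type*} [AddCommGroup 𝔸] [Module ℝ 𝔸]

open Classical in
/-- **the extension by zero** of a field given on a bond class `P` to all bonds of `ℤᵈ` (the block pieces `1_{π⁻¹(v)}λ` of print's summation live on such
classes). [cite: Balaban1985BackgroundPropagators, (3.42) p.397 («supp λ ⊂ Δ(y′)»)] -/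
def extZd (P : Site d × Fin d → Prop) (g : {b : Site d × Fin d // P b} → 𝔸) : Site d → Fin d → 𝔸 :=
  fun z μ => if h : P (z, μ) then g ⟨(z, μ), h⟩ else 0

omit [Module ℝ 𝔸] in
/-- on the class, the extension is the field. [cite: Balaban1985BackgroundPropagators, (3.42) p.397 (bookkeeping)] -/
theorem extZd_apply_of {P : Site d × Fin d → Prop} (g : {b : Site d × Fin d // P b} → 𝔸) (b : {b : Site d × Fin d // P b}) :
    extZd P g b.1.1 b.1.2 = g b := by
  classical
  unfold extZd
  rw [dif_pos b.2]

omit [Module ℝ 𝔸] in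
/-- off the class, the extension vanishes. [cite: Balaban1985BackgroundPropagators, (3.42) p.397 (bookkeeping)] -/
theorem extZd_apply_of_not {P : Site d × Fin d → Prop} (g : {b : Site d × Fin d // P b} → 𝔸) {z : Site d} {μ : Fin d}
    (h : ¬ P (z, μ)) : extZd P g z μ = 0 := by
  classical
  unfold extZd
  rw [dif_neg h]

omit [Module ℝ 𝔸] in
/-- the extension is additive. [cite: Balaban1985BackgroundPropagators, (3.42) p.397 (bookkeeping)] -/
theorem extZd_add (P : Site d × Fin d → Prop) (g g' : {b : Site d × Fin d // P b} → 𝔸) :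
    extZd P (g + g') = extZd P g + extZd P g' := by
  classical
  funext z μ
  by_cases h : P (z, μ)
  · simp only [extZd, dif_pos h, Pi.add_apply]
  · simp only [extZd, dif_neg h, Pi.add_apply, add_zero]

/-- the extension is ℝ-homogeneous. [cite: Balaban1985BackgroundPropagators, (3.42) p.397 (bookkeeping)] -/
theorem extZd_smul (P : Site d × Fin d → Prop) (c : ℝ) (g : {b : Site d × Fin d // P b} → 𝔸) :
    extZd P (c • g) = c • extZd P g := by
  classical
  funext z μ
  by_cases h : P (z, μ)
  · simp only [extZd, dif_pos h, Pi.smul_apply]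
  · simp only [extZd, dif_neg h, Pi.smul_apply, smul_zero]

end Ext

/-! ## §3 The letters `∇_U`, `∇*_U`, `Δ_U` are ℝ-linear -/

section Linear

variable {𝔸 : Type} [CStarAlgebra 𝔸]

/-- the forward covariant derivative (1.1) is ℝ-linear in the site function. [cite: Balaban1985RegularSpaces, (1.1) p.76] -/
theorem covDerivFwd_linear (η : ℝ) (V : Site d → Fin d → 𝔸ˣ) (μ : Fin d) (c : ℝ) (F G : Site d → 𝔸) (x : Site d) :
    covDerivFwd η V μ (fun w => c • F w + G w) x = c • covDerivFwd η V μ F x + covDerivFwd η V μ G x := by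
  simp only [B8Ineq132.covDerivFwd, B7Eq78Linearization.conjR_apply, mul_add, add_mul,
    mul_smul_comm, smul_mul_assoc, smul_add, smul_sub, smul_smul, mul_comm c]
  abel

/-- the backward covariant derivative (1.1) is ℝ-linear in the site function. [cite: Balaban1985RegularSpaces, (1.1) p.76] -/
theorem covDeriv_linear (η : ℝ) (V : Site d → Fin d → 𝔸ˣ) (μ : Fin d) (c : ℝ) (F G : Site d → 𝔸) (x : Site d) :
    covDeriv η V μ (fun w => c • F w + G w) x = c • covDeriv η V μ F x + covDeriv η V μ G x := by
  simp only [B8Ineq132.covDeriv, B7Eq78Linearization.conjR_apply, mul_add, add_mul,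
    mul_smul_comm, smul_mul_assoc, smul_add, smul_sub, smul_smul, mul_comm c]
  abel

/-- `∇_{U,ν}` on bond fields is ℝ-linear. [cite: Balaban1985BackgroundPropagators, (3.42) p.397; Balaban1985RegularSpaces, (1.1) p.76] -/
theorem cdBZd_linear (η : ℝ) (U : Site d → Fin d → 𝔸ˣ) (ν : Fin d) (c : ℝ) (A B : Site d → Fin d → 𝔸) :
    cdBZd η U ν (c • A + B) = c • cdBZd η U ν A + cdBZd η U ν B := by
  funext z μ
  simp only [cdBZd, Pi.add_apply, Pi.smul_apply]
  exact covDerivFwd_linear η U ν c (fun w => A w μ) (fun w => B w μ) z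

/-- `∇*_{U,ν}` on bond fields is ℝ-linear. [cite: Balaban1985BackgroundPropagators, (3.42) p.397; Balaban1985RegularSpaces, (1.1) p.76] -/
theorem cdsBZd_linear (η : ℝ) (U : Site d → Fin d → 𝔸ˣ) (ν : Fin d) (c : ℝ) (A B : Site d → Fin d → 𝔸) :
    cdsBZd η U ν (c • A + B) = c • cdsBZd η U ν A + cdsBZd η U ν B := by
  funext z μ
  simp only [cdsBZd, Pi.add_apply, Pi.smul_apply]
  exact covDeriv_linear η U ν c (fun w => A w μ) (fun w => B w μ) z

/-- `Δ_U` on bond fields is ℝ-linear. [cite: Balaban1985BackgroundPropagators, (3.23) p.394, (3.42) p.397] -/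
theorem lapBZd_linear (η : ℝ) (U : Site d → Fin d → 𝔸ˣ) (c : ℝ) (A B : Site d → Fin d → 𝔸) :
    lapBZd η U (c • A + B) = c • lapBZd η U A + lapBZd η U B := by
  funext z μ
  simp only [lapBZd, Pi.add_apply, Pi.smul_apply, B8Eq138LandauZd.covLap, B8Eq138LandauZd.covDivB, covDerivFwd_linear,
    covDeriv_linear, Finset.sum_add_distrib, Finset.smul_sum]

end Linear

/-! ## §4 The generic summation: a post-letter dominated by an entry of (3.42) -/

section Main

variable {𝔸 : Type} [CStarAlgebra 𝔸] {L : ℕ} {len : Site d → ℝ}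

/-- ★★ **LOCAL (3.42)ₙ AT THE GENUINE READINGS ⟹ THE GLOBAL WEIGHTED BOUND OF (3.47)'s SHAPE**, on a member with finitely many blocks.  Data: the
(3.42) block `h342` of `B9.Ineq342_346_347 (GAZdOfOps … ops) B₀ δ₀ U`; an ℝ-linear letter `Θ` on bond fields (displayed `hΘ`) DOMINATED by the entry-`n`
reading of `G(U) = ops.Gop U` on every block (`hdom` — `Θ = G(U)`, `∇_{U,ν}∘G(U)`, `G(U)∘∇*_{U,ν}`, `Δ_U∘G(U)` for `n = 0, 1, 2, 3`); a bond class `P` whose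
bonds carry a base-block assignment `π` (`hπ`); the exchange letter (2.60) and the row letter (2.61) of [4] Lemma 2.1 DISPLAYED.  Conclusion: for every
`f` on the class with `ω(π y)·‖f(y)‖ ≤ M`, at every bond `b` of the class, `ω′(π b)·‖(Θ f̃)(b)‖ ≤ B₀·R·S·M` (`f̃ = extZd P f`).  Proof = leaf-03's
`weight_mul_norm_apply_le_of_local` at `T g := Θ g̃` restricted to the class, the local letter supplied by `ineq342_of_GAZdOfOps` + `hdom`.
[cite: Balaban1985BackgroundPropagators, Thm 3.1 (3.42) p.397 + (3.47) p.398 (l.19–20); Balaban1984PropagatorsII, Lemma 2.1 (2.60)–(2.61) p.234] -/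
theorem weight_mul_norm_le_of_reading {x : MemberZd d L} [Fintype (BSite L x)] {ops : OpsZd d 𝔸} {U : CfgZd d 𝔸}
    {B₀ δ₀ : ℝ} (hB₀ : 0 ≤ B₀) (h342 : B9.Ineq342_346_347 (GAZdOfOps 𝔸 L len x ops) B₀ δ₀ U)
    (n : Fin 4) (Θ : (Site d → Fin d → 𝔸) → (Site d → Fin d → 𝔸))
    (hΘ : ∀ (c : ℝ) (A B : Site d → Fin d → 𝔸), Θ (c • A + B) = c • Θ A + Θ B)
    {P : Site d × Fin d → Prop} (π : {b : Site d × Fin d // P b} → BSite L x)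
    (hπ : ∀ b, b.1.1 ∈ blockZd L (π b).1.1 (π b).1.2)
    (hdom : ∀ (J : Site d → Fin d → 𝔸) (b : {b : Site d × Fin d // P b}), ‖Θ J b.1.1 b.1.2‖ ≤ eOfOps 𝔸 L ops x n U J (π b))
    {κ₂ R S : ℝ} (hR : 0 ≤ R) {ω ω' : BSite L x → ℝ} (hω : ∀ v, 0 < ω v) (hω' : ∀ u, 0 ≤ ω' u)
    (hex : ∀ u v : BSite L x, ω' u * B9.pref4 ((L : ℝ) ^ u.1.1 * x.i.η) n ≤ R * Real.exp (κ₂ * distZd L x u v) * ω v)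
    (hS : ∀ u : BSite L x, ∑ v, Real.exp (-((δ₀ - κ₂) * distZd L x u v)) ≤ S)
    (f : {b : Site d × Fin d // P b} → 𝔸) {M : ℝ} (hM : 0 ≤ M) (hMf : ∀ y, ω (π y) * ‖f y‖ ≤ M)
    (b : {b : Site d × Fin d // P b}) :
    ω' (π b) * ‖Θ (extZd P f) b.1.1 b.1.2‖ ≤ B₀ * R * S * M := by
  -- `Θ 0 = 0` from the displayed linearity
  have hΘ0 : Θ (0 : Site d → Fin d → 𝔸) = 0 := by
    have h1 := hΘ 1 (0 : Site d → Fin d → 𝔸) 0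
    rw [one_smul, one_smul, add_zero] at h1
    have : Θ 0 + Θ 0 = Θ 0 + 0 := by rw [add_zero]; exact h1.symm
    exact add_left_cancel this
  -- `g ↦ Θ g̃` restricted to the class, as an ℝ-linear map
  let T : ({b : Site d × Fin d // P b} → 𝔸) →ₗ[ℝ] ({b : Site d × Fin d // P b} → 𝔸) :=
    { toFun := fun g b => Θ (extZd P g) b.1.1 b.1.2
      map_add' := fun g g' => by
        funext b'
        have h := hΘ 1 (extZd P g) (extZd P g')
        rw [one_smul, one_smul] at h
        rw [extZd_add, h]
        rfl
      map_smul' := fun c g => by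
        funext b'
        have h := hΘ c (extZd P g) 0
        rw [add_zero, hΘ0, add_zero] at h
        rw [extZd_smul, h]
        rfl }
  have hloc : ∀ (v : BSite L x) (g : {b : Site d × Fin d // P b} → 𝔸) (F : ℝ), (∀ y, π y ≠ v → g y = 0) → (∀ y, ‖g y‖ ≤ F) →
      ∀ b', ‖T g b'‖ ≤ B₀ * (fun u : BSite L x => B9.pref4 ((L : ℝ) ^ u.1.1 * x.i.η) n) (π b') *
        Real.exp (-(δ₀ * distZd L x (π b') v)) * F := by
    intro v g F hgv hgF b'
    have hF0 : 0 ≤ F := (norm_nonneg _).trans (hgF b')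
    -- the extension is supported on the bonds of `Δ(v)`
    have hsupp : ∀ (z : Site d) (μ : Fin d), extZd P g z μ ≠ 0 → BondTouches (blockZd L v.1.1 v.1.2) z μ := by
      intro z μ hne
      classical
      by_cases hP : P (z, μ)
      · have hy : π ⟨(z, μ), hP⟩ = v := by
          by_contra hne'
          exact hne (by rw [show extZd P g z μ = g ⟨(z, μ), hP⟩ from extZd_apply_of g ⟨(z, μ), hP⟩, hgv _ hne'])
        have hmem := hπ ⟨(z, μ), hP⟩
        rw [hy] at hmem
        exact Or.inl hmem
      · exact absurd (extZd_apply_of_not g hP) hne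
    have h1 := ineq342_of_GAZdOfOps (𝔸 := 𝔸) (L := L) (len := len) h342 n (extZd P g) (π b') v hsupp
    have h2 : ‖T g b'‖ ≤ eOfOps 𝔸 L ops x n U (extZd P g) (π b') := hdom (extZd P g) b'
    have h3 : supNormZd (extZd P g) ≤ F := by
      refine supNormZd_le_of_forall hF0 fun z μ => ?_
      classical
      by_cases hP : P (z, μ)
      · rw [show extZd P g z μ = g ⟨(z, μ), hP⟩ from extZd_apply_of g ⟨(z, μ), hP⟩]; exact hgF _
      · rw [extZd_apply_of_not g hP, norm_zero]; exact hF0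
    have hpref : 0 ≤ B9.pref4 ((L : ℝ) ^ (π b').1.1 * x.i.η) n := by
      have hs : 0 ≤ (L : ℝ) ^ (π b').1.1 * x.i.η := by have := x.i.hη.le; positivity
      fin_cases n <;> simp [B9.pref4] <;> positivity
    have h4 : 0 ≤ B₀ * B9.pref4 ((L : ℝ) ^ (π b').1.1 * x.i.η) n * Real.exp (-(δ₀ * distZd L x (π b') v)) := by positivity
    calc ‖T g b'‖ ≤ eOfOps 𝔸 L ops x n U (extZd P g) (π b') := h2
      _ ≤ B₀ * B9.pref4 ((L : ℝ) ^ (π b').1.1 * x.i.η) n * Real.exp (-(δ₀ * distZd L x (π b') v)) * supNormZd (extZd P g) := h1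
      _ ≤ B₀ * B9.pref4 ((L : ℝ) ^ (π b').1.1 * x.i.η) n * Real.exp (-(δ₀ * distZd L x (π b') v)) * F :=
          mul_le_mul_of_nonneg_left h3 h4
  exact weight_mul_norm_apply_le_of_local π π (distZd L x) T (κ := δ₀) (κ₂ := κ₂)
    (a := fun u : BSite L x => B9.pref4 ((L : ℝ) ^ u.1.1 * x.i.η) n) hB₀ hR hω hω' hloc hex hS f hM hMf b

/-- the composite of two displayed-ℝ-linear letters is ℝ-linear. [cite: Balaban1985BackgroundPropagators, (3.42) p.397 (bookkeeping)] -/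
theorem comp_linear {Θ Ψ : (Site d → Fin d → 𝔸) → (Site d → Fin d → 𝔸)}
    (hΘ : ∀ (c : ℝ) (A B : Site d → Fin d → 𝔸), Θ (c • A + B) = c • Θ A + Θ B)
    (hΨ : ∀ (c : ℝ) (A B : Site d → Fin d → 𝔸), Ψ (c • A + B) = c • Ψ A + Ψ B) :
    ∀ (c : ℝ) (A B : Site d → Fin d → 𝔸), Θ (Ψ (c • A + B)) = c • Θ (Ψ A) + Θ (Ψ B) := fun c A B => by
  rw [hΨ, hΘ]

/-! ## §5 The four (3.47) entries: `G J`, `∇_U G J`, `G∇*_U J`, `Δ_U G J` -/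

/-- ★★ **ENTRY n = 0: `|G(U₀)J|`** — (3.42)₀ at the genuine reading + the Lemma-2.1 letters ⟹ `ω′(π b)·‖(G(U₀) f̃)(b)‖ ≤ B₀·R·S·M` (local factor `(Lʲη)²`;
print: `|Gλ|_{(2+γ)} ≤ B₀c|λ|_{(γ)}` with block weights `ω′ = (Lʲη)^{−(2+γ)}`, `ω = (L^{j′}η)^{−γ}`).
[cite: Balaban1985BackgroundPropagators, (3.47) p.398, (3.42) p.397; Balaban1984PropagatorsII, Lemma 2.1 p.234] -/
theorem weight_mul_norm_gop_le_of_ineq342 {x : MemberZd d L} [Fintype (BSite L x)] {ops : OpsZd d 𝔸} {U : CfgZd d 𝔸}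
    {B₀ δ₀ : ℝ} (hB₀ : 0 ≤ B₀) (h342 : B9.Ineq342_346_347 (GAZdOfOps 𝔸 L len x ops) B₀ δ₀ U)
    (hlin : ∀ (c : ℝ) (A B : Site d → Fin d → 𝔸), ops.Gop U.1 (c • A + B) = c • ops.Gop U.1 A + ops.Gop U.1 B)
    {P : Site d × Fin d → Prop} (π : {b : Site d × Fin d // P b} → BSite L x)
    (hπ : ∀ b, b.1.1 ∈ blockZd L (π b).1.1 (π b).1.2)
    {κ₂ R S : ℝ} (hR : 0 ≤ R) {ω ω' : BSite L x → ℝ} (hω : ∀ v, 0 < ω v) (hω' : ∀ u, 0 ≤ ω' u)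
    (hex : ∀ u v : BSite L x, ω' u * ((L : ℝ) ^ u.1.1 * x.i.η) ^ 2 ≤ R * Real.exp (κ₂ * distZd L x u v) * ω v)
    (hS : ∀ u : BSite L x, ∑ v, Real.exp (-((δ₀ - κ₂) * distZd L x u v)) ≤ S)
    (f : {b : Site d × Fin d // P b} → 𝔸) {M : ℝ} (hM : 0 ≤ M) (hMf : ∀ y, ω (π y) * ‖f y‖ ≤ M)
    (b : {b : Site d × Fin d // P b}) :
    ω' (π b) * ‖ops.Gop U.1 (extZd P f) b.1.1 b.1.2‖ ≤ B₀ * R * S * M :=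
  weight_mul_norm_le_of_reading hB₀ h342 0 (ops.Gop U.1) hlin π hπ
    (fun J b' => norm_le_supBlkZd L (π b') (ops.Gop U.1 J) (Or.inl (hπ b'))) hR hω hω'
    (fun u v => by simpa [B9.pref4] using hex u v) hS f hM hMf b

/-- ★★ **ENTRY n = 1: `|∇_{U₀,ν}G(U₀)J|`** (every component `ν`; local factor `Lʲη`; print: `|∇_UGλ|_{(1+γ)} ≤ B₀c|λ|_{(γ)}`).
[cite: Balaban1985BackgroundPropagators, (3.47) p.398, (3.42) p.397; Balaban1984PropagatorsII, Lemma 2.1 p.234] -/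
theorem weight_mul_norm_gradGop_le_of_ineq342 {x : MemberZd d L} [Fintype (BSite L x)] {ops : OpsZd d 𝔸} {U : CfgZd d 𝔸}
    {B₀ δ₀ : ℝ} (hB₀ : 0 ≤ B₀) (h342 : B9.Ineq342_346_347 (GAZdOfOps 𝔸 L len x ops) B₀ δ₀ U)
    (hlin : ∀ (c : ℝ) (A B : Site d → Fin d → 𝔸), ops.Gop U.1 (c • A + B) = c • ops.Gop U.1 A + ops.Gop U.1 B)
    {P : Site d × Fin d → Prop} (π : {b : Site d × Fin d // P b} → BSite L x)
    (hπ : ∀ b, b.1.1 ∈ blockZd L (π b).1.1 (π b).1.2)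
    {κ₂ R S : ℝ} (hR : 0 ≤ R) {ω ω' : BSite L x → ℝ} (hω : ∀ v, 0 < ω v) (hω' : ∀ u, 0 ≤ ω' u)
    (hex : ∀ u v : BSite L x, ω' u * ((L : ℝ) ^ u.1.1 * x.i.η) ≤ R * Real.exp (κ₂ * distZd L x u v) * ω v)
    (hS : ∀ u : BSite L x, ∑ v, Real.exp (-((δ₀ - κ₂) * distZd L x u v)) ≤ S)
    (ν : Fin d) (f : {b : Site d × Fin d // P b} → 𝔸) {M : ℝ} (hM : 0 ≤ M) (hMf : ∀ y, ω (π y) * ‖f y‖ ≤ M)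
    (b : {b : Site d × Fin d // P b}) :
    ω' (π b) * ‖cdBZd x.i.η U.1 ν (ops.Gop U.1 (extZd P f)) b.1.1 b.1.2‖ ≤ B₀ * R * S * M := by
  refine weight_mul_norm_le_of_reading hB₀ h342 1 (fun J => cdBZd x.i.η U.1 ν (ops.Gop U.1 J))
    (comp_linear (cdBZd_linear x.i.η U.1 ν) hlin) π hπ ?_ hR hω hω' (fun u v => by simpa [B9.pref4] using hex u v) hS f hM hMf b
  intro J b'
  have h1 : ‖cdBZd x.i.η U.1 ν (ops.Gop U.1 J) b'.1.1 b'.1.2‖ ≤ supBlkZd L (π b') (cdBZd x.i.η U.1 ν (ops.Gop U.1 J)) :=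
    norm_le_supBlkZd L (π b') _ (Or.inl (hπ b'))
  have h2 : supBlkZd L (π b') (cdBZd x.i.η U.1 ν (ops.Gop U.1 J)) ≤
      ⨆ ν' : Fin d, supBlkZd L (π b') (cdBZd x.i.η U.1 ν' (ops.Gop U.1 J)) :=
    le_ciSup (f := fun ν' : Fin d => supBlkZd L (π b') (cdBZd x.i.η U.1 ν' (ops.Gop U.1 J))) (Set.finite_range _).bddAbove ν
  simpa [eOfOps] using h1.trans h2

/-- ★★ **ENTRY n = 2: `|G(U₀)∇*_{U₀,ν}J|`** (the input-side letter; local factor `Lʲη`; print: `|G∇*_Uλ|_{(1+γ)} ≤ B₀c|λ|_{(γ)}`).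
[cite: Balaban1985BackgroundPropagators, (3.47) p.398, (3.42) p.397; Balaban1984PropagatorsII, Lemma 2.1 p.234] -/
theorem weight_mul_norm_gopDiv_le_of_ineq342 {x : MemberZd d L} [Fintype (BSite L x)] {ops : OpsZd d 𝔸} {U : CfgZd d 𝔸}
    {B₀ δ₀ : ℝ} (hB₀ : 0 ≤ B₀) (h342 : B9.Ineq342_346_347 (GAZdOfOps 𝔸 L len x ops) B₀ δ₀ U)
    (hlin : ∀ (c : ℝ) (A B : Site d → Fin d → 𝔸), ops.Gop U.1 (c • A + B) = c • ops.Gop U.1 A + ops.Gop U.1 B)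
    {P : Site d × Fin d → Prop} (π : {b : Site d × Fin d // P b} → BSite L x)
    (hπ : ∀ b, b.1.1 ∈ blockZd L (π b).1.1 (π b).1.2)
    {κ₂ R S : ℝ} (hR : 0 ≤ R) {ω ω' : BSite L x → ℝ} (hω : ∀ v, 0 < ω v) (hω' : ∀ u, 0 ≤ ω' u)
    (hex : ∀ u v : BSite L x, ω' u * ((L : ℝ) ^ u.1.1 * x.i.η) ≤ R * Real.exp (κ₂ * distZd L x u v) * ω v)
    (hS : ∀ u : BSite L x, ∑ v, Real.exp (-((δ₀ - κ₂) * distZd L x u v)) ≤ S)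
    (ν : Fin d) (f : {b : Site d × Fin d // P b} → 𝔸) {M : ℝ} (hM : 0 ≤ M) (hMf : ∀ y, ω (π y) * ‖f y‖ ≤ M)
    (b : {b : Site d × Fin d // P b}) :
    ω' (π b) * ‖ops.Gop U.1 (cdsBZd x.i.η U.1 ν (extZd P f)) b.1.1 b.1.2‖ ≤ B₀ * R * S * M := by
  refine weight_mul_norm_le_of_reading hB₀ h342 2 (fun J => ops.Gop U.1 (cdsBZd x.i.η U.1 ν J))
    (comp_linear hlin (cdsBZd_linear x.i.η U.1 ν)) π hπ ?_ hR hω hω' (fun u v => by simpa [B9.pref4] using hex u v) hS f hM hMf b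
  intro J b'
  have h1 : ‖ops.Gop U.1 (cdsBZd x.i.η U.1 ν J) b'.1.1 b'.1.2‖ ≤ supBlkZd L (π b') (ops.Gop U.1 (cdsBZd x.i.η U.1 ν J)) :=
    norm_le_supBlkZd L (π b') _ (Or.inl (hπ b'))
  have h2 : supBlkZd L (π b') (ops.Gop U.1 (cdsBZd x.i.η U.1 ν J)) ≤
      ⨆ ν' : Fin d, supBlkZd L (π b') (ops.Gop U.1 (cdsBZd x.i.η U.1 ν' J)) :=
    le_ciSup (f := fun ν' : Fin d => supBlkZd L (π b') (ops.Gop U.1 (cdsBZd x.i.η U.1 ν' J))) (Set.finite_range _).bddAbove ν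
  simpa [eOfOps] using h1.trans h2

/-- ★★ **ENTRY n = 3: `|Δ_{U₀}G(U₀)J|`** (local factor `1`; print: `|Δ_UGλ|_{(γ)} ≤ B₀c|λ|_{(γ)}`, the corrected fourth entry of (3.47)).
[cite: Balaban1985BackgroundPropagators, (3.47) p.398, (3.42) p.397; Balaban1984PropagatorsII, Lemma 2.1 p.234] -/
theorem weight_mul_norm_lapGop_le_of_ineq342 {x : MemberZd d L} [Fintype (BSite L x)] {ops : OpsZd d 𝔸} {U : CfgZd d 𝔸}
    {B₀ δ₀ : ℝ} (hB₀ : 0 ≤ B₀) (h342 : B9.Ineq342_346_347 (GAZdOfOps 𝔸 L len x ops) B₀ δ₀ U)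
    (hlin : ∀ (c : ℝ) (A B : Site d → Fin d → 𝔸), ops.Gop U.1 (c • A + B) = c • ops.Gop U.1 A + ops.Gop U.1 B)
    {P : Site d × Fin d → Prop} (π : {b : Site d × Fin d // P b} → BSite L x)
    (hπ : ∀ b, b.1.1 ∈ blockZd L (π b).1.1 (π b).1.2)
    {κ₂ R S : ℝ} (hR : 0 ≤ R) {ω ω' : BSite L x → ℝ} (hω : ∀ v, 0 < ω v) (hω' : ∀ u, 0 ≤ ω' u)
    (hex : ∀ u v : BSite L x, ω' u ≤ R * Real.exp (κ₂ * distZd L x u v) * ω v)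
    (hS : ∀ u : BSite L x, ∑ v, Real.exp (-((δ₀ - κ₂) * distZd L x u v)) ≤ S)
    (f : {b : Site d × Fin d // P b} → 𝔸) {M : ℝ} (hM : 0 ≤ M) (hMf : ∀ y, ω (π y) * ‖f y‖ ≤ M)
    (b : {b : Site d × Fin d // P b}) :
    ω' (π b) * ‖lapBZd x.i.η U.1 (ops.Gop U.1 (extZd P f)) b.1.1 b.1.2‖ ≤ B₀ * R * S * M :=
  weight_mul_norm_le_of_reading hB₀ h342 3 (fun J => lapBZd x.i.η U.1 (ops.Gop U.1 J)) (comp_linear (lapBZd_linear x.i.η U.1) hlin) π hπ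
    (fun J b' => by simpa [eOfOps] using norm_le_supBlkZd L (π b') (lapBZd x.i.η U.1 (ops.Gop U.1 J)) (Or.inl (hπ b')))
    hR hω hω' (fun u v => by simpa [B9.pref4] using hex u v) hS f hM hMf b

end Main

end Literature.MathematicalPhysics.QuantumFieldTheory.Balaban1983to89.B9Eq347GlobalFromLocalZd

end
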